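import Mathlib
import Summits.Ventures.PercRepro2.WForm
import Summits.Ventures.PercRepro2.WAltDefs

/-!
# The alternating (Gibbs-sampler) argument for W-forms, II: the theorem
(blind cell PercRepro2, mine-1 g15; proofs/MINE1-W-THEOREM.md §3–§4)

**`Q_nonneg_of_alternating`**: a weight `W` on a finite preorder `α` with a symmetric,
antitone compatibility relation `D` satisfies the W-inequality `Q D W g h ≥ 0` for all monotone
`g, h` as soon as (H1 = `CondPA`) every conditional weight `cw (·, t) = W · 1[D · t]` is
positively associated for monotone pairs, and a hub `t₀` compatible with everything has
positive weight.
Proof: `Q D W g h ≥ pairSum (Kg − g) (Kh − h)` (one Harris step (H1) at every `t`,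
`pairSum_le_Q`); `pairSum (K u) (K v) ≤ pairSum u v` for a pair of the same monotonicity type
(`pairSum_K_le`); `K` maps monotone functions to antitone ones and conversely
(`antitone_K_of_monotone`, from (H1) and the antitonicity of `D`), so the iterates
`K^n (Kg − g)`, `K^n (Kh − h)` stay a same-type pair with `q`-mean zero; their oscillation
contracts geometrically (`osc_iterate_le`, from the Doeblin bounds of part I) and a mean-zero
pair sum is bounded below by `−(∑ q) · osc · osc` (`neg_le_pairSum`); the Archimedean property
finishes.
-/

namespace Summit.Ventures.PercRepro2.WForm

section AltMean

variable {R : Type*} [Field R] [LinearOrder R] [IsStrictOrderedRing R]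
variable {α : Type*} [Fintype α] [DecidableEq α]
variable {D : α → α → Prop} [DecidableRel D] {W : α → R}

/-- The oscillation contracts under `K`: `osc (K u) ≤ (1 − ε) osc u`. -/
lemma osc_K_le (hW : ∀ s, 0 ≤ W s) {t₀ : α} (hD0 : ∀ t, D t₀ t) (h0 : 0 < W t₀) (u : α → R) :
    hi t₀ (K D W u) - lo t₀ (K D W u) ≤ (1 - eps W t₀) * (hi t₀ u - lo t₀ u) := by
  have h1 : hi t₀ (K D W u) ≤ hi t₀ u - eps W t₀ * (hi t₀ u - u t₀) :=
    hi_le fun t => K_le_hi_sub hW hD0 h0 u t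
  have h2 : lo t₀ u + eps W t₀ * (u t₀ - lo t₀ u) ≤ lo t₀ (K D W u) :=
    le_lo fun t => lo_add_le_K hW hD0 h0 u t
  nlinarith [h1, h2]

omit [DecidableEq α] in
/-- A `q`-mean-zero function has `lo ≤ 0 ≤ hi`. -/
lemma lo_nonpos_hi_nonneg_of_mean_zero (hW : ∀ s, 0 ≤ W s) (t₀ : α)
    (hM : 0 < ∑ t, q D W t) {u : α → R} (h0 : ∑ t, q D W t * u t = 0) :
    lo t₀ u ≤ 0 ∧ 0 ≤ hi t₀ u := by
  constructor
  · by_contra h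
    rw [not_le] at h
    have : (∑ t, q D W t) * lo t₀ u ≤ ∑ t, q D W t * u t := by
      rw [Finset.sum_mul]
      exact Finset.sum_le_sum fun t _ => mul_le_mul_of_nonneg_left (lo_le t₀ u t) (q_nonneg hW t)
    rw [h0] at this
    exact absurd this (not_le.mpr (mul_pos hM h))
  · by_contra h
    rw [not_le] at h
    have : ∑ t, q D W t * u t ≤ (∑ t, q D W t) * hi t₀ u := by
      rw [Finset.sum_mul]
      exact Finset.sum_le_sum fun t _ => mul_le_mul_of_nonneg_left (le_hi t₀ u t) (q_nonneg hW t)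
    rw [h0] at this
    exact absurd this (not_le.mpr (mul_neg_of_pos_of_neg hM h))

omit [DecidableEq α] in
/-- `|u t| ≤ osc u` for a mean-zero `u`. -/
lemma abs_le_osc (t₀ : α) {u : α → R} (h : lo t₀ u ≤ 0 ∧ 0 ≤ hi t₀ u) (t : α) :
    |u t| ≤ hi t₀ u - lo t₀ u := by
  rw [abs_le]
  constructor
  · linarith [lo_le t₀ u t]
  · linarith [le_hi t₀ u t]

omit [DecidableEq α] in
/-- The pair sum of two mean-zero functions is bounded below by `−(∑ q) osc u osc v`. -/
lemma neg_le_pairSum (hW : ∀ s, 0 ≤ W s) (t₀ : α) (hM : 0 < ∑ t, q D W t) {u v : α → R}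
    (hu : ∑ t, q D W t * u t = 0) (hv : ∑ t, q D W t * v t = 0) :
    -((∑ t, q D W t) * ((hi t₀ u - lo t₀ u) * (hi t₀ v - lo t₀ v))) ≤ pairSum D W u v := by
  have hu' := lo_nonpos_hi_nonneg_of_mean_zero hW t₀ hM hu
  have hv' := lo_nonpos_hi_nonneg_of_mean_zero hW t₀ hM hv
  unfold pairSum
  rw [neg_mul_eq_mul_neg, Finset.sum_mul]
  refine Finset.sum_le_sum fun t _ => ?_
  refine mul_le_mul_of_nonneg_left ?_ (q_nonneg hW t)
  have h1 := abs_le_osc t₀ hu' t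
  have h2 := abs_le_osc t₀ hv' t
  have h3 : -(|u t| * |v t|) ≤ u t * v t := by
    rw [← abs_mul]; exact neg_abs_le _
  have h4 : |u t| * |v t| ≤ (hi t₀ u - lo t₀ u) * (hi t₀ v - lo t₀ v) :=
    mul_le_mul h1 h2 (abs_nonneg _) (by linarith [hu'.1, hu'.2])
  linarith

end AltMean

section AltMono

variable {R : Type*} [Field R] [LinearOrder R] [IsStrictOrderedRing R]
variable {α : Type*} [Fintype α] [DecidableEq α] [Preorder α]
variable {D : α → α → Prop} [DecidableRel D] {W : α → R}

omit [DecidableEq α] in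
/-- **(H1) in the `K` form** for monotone `g, h`. -/
lemma Z_mul_K_mul_K_le (hH1 : CondPA D W) {t : α} (hZ : 0 < Z D W t) {g h : α → R}
    (hg : Monotone g) (hh : Monotone h) :
    Z D W t * (K D W g t * K D W h t) ≤ ∑ s, cw D W s t * (g s * h s) := by
  have h1 := hH1 t g h hg hh
  rw [sum_cw_mul_eq_K_mul_Z g hZ.ne', sum_cw_mul_eq_K_mul_Z h hZ.ne'] at h1
  have h2 : Z D W t * (Z D W t * (K D W g t * K D W h t)) ≤
      Z D W t * (∑ s, cw D W s t * (g s * h s)) := by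
    calc Z D W t * (Z D W t * (K D W g t * K D W h t))
        = K D W g t * Z D W t * (K D W h t * Z D W t) := by ring
      _ ≤ (∑ s, cw D W s t * (g s * h s)) * Z D W t := h1
      _ = Z D W t * (∑ s, cw D W s t * (g s * h s)) := by ring
  exact le_of_mul_le_mul_left h2 hZ

omit [DecidableEq α] in
/-- **(H1) in the `K` form** for antitone `g, h`. -/
lemma Z_mul_K_mul_K_le_of_antitone (hH1 : CondPA D W) {t : α} (hZ : 0 < Z D W t) {g h : α → R}
    (hg : Antitone g) (hh : Antitone h) :
    Z D W t * (K D W g t * K D W h t) ≤ ∑ s, cw D W s t * (g s * h s) := by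
  have hg' : Monotone (fun s => - g s) := fun a b hab => neg_le_neg (hg hab)
  have hh' : Monotone (fun s => - h s) := fun a b hab => neg_le_neg (hh hab)
  have h1 := Z_mul_K_mul_K_le hH1 hZ hg' hh'
  rw [K_neg, K_neg] at h1
  simpa only [neg_mul_neg] using h1

/-- Two functions of the same monotonicity type. -/
def SameType (u v : α → R) : Prop := (Monotone u ∧ Monotone v) ∨ (Antitone u ∧ Antitone v)

omit [DecidableEq α] in
/-- **(H1) in the `K` form** for a pair of the same type. -/
lemma Z_mul_K_mul_K_le_of_sameType (hH1 : CondPA D W) {t : α} (hZ : 0 < Z D W t) {u v : α → R}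
    (huv : SameType u v) :
    Z D W t * (K D W u t * K D W v t) ≤ ∑ s, cw D W s t * (u s * v s) := by
  rcases huv with ⟨hu, hv⟩ | ⟨hu, hv⟩
  · exact Z_mul_K_mul_K_le hH1 hZ hu hv
  · exact Z_mul_K_mul_K_le_of_antitone hH1 hZ hu hv

omit [DecidableEq α] in
/-- **Step 1**: `Q D W g h ≥ Σ_t q t (K g t − g t)(K h t − h t)`. -/
lemma pairSum_le_Q (hW : ∀ s, 0 ≤ W s) (hZ : ∀ t, 0 < Z D W t) (hH1 : CondPA D W)
    {g h : α → R} (hg : Monotone g) (hh : Monotone h) :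
    pairSum D W (fun t => K D W g t - g t) (fun t => K D W h t - h t) ≤ Q D W g h := by
  rw [Q_eq_sum_cw]
  unfold pairSum q
  refine Finset.sum_le_sum fun t _ => ?_
  rw [mul_assoc]
  refine mul_le_mul_of_nonneg_left ?_ (hW t)
  have hg' : Monotone (fun s => g s - g t) := fun a b hab => by simp only; linarith [hg hab]
  have hh' : Monotone (fun s => h s - h t) := fun a b hab => by simp only; linarith [hh hab]
  have := Z_mul_K_mul_K_le hH1 (hZ t) hg' hh'
  rw [K_sub_const g (g t) (hZ t).ne', K_sub_const h (h t) (hZ t).ne'] at this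
  exact this

omit [DecidableEq α] in
/-- **Step 2**: `pairSum (K u) (K v) ≤ pairSum u v` for a pair of the same type. -/
lemma pairSum_K_le (hW : ∀ s, 0 ≤ W s) (hD : ∀ s t, D s t → D t s) (hZ : ∀ t, 0 < Z D W t)
    (hH1 : CondPA D W) {u v : α → R} (huv : SameType u v) :
    pairSum D W (K D W u) (K D W v) ≤ pairSum D W u v := by
  rw [pairSum_eq hD u v]
  unfold pairSum q
  refine Finset.sum_le_sum fun t _ => ?_
  rw [mul_assoc]
  exact mul_le_mul_of_nonneg_left (Z_mul_K_mul_K_le_of_sameType hH1 (hZ t) huv) (hW t)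

omit [DecidableEq α] [LinearOrder R] [IsStrictOrderedRing R] [Fintype α] in
/-- `cw s t * 1[D s t'] = cw s t'` when `t ≤ t'` and `D` is antitone in its second argument. -/
lemma cw_mul_indicator (hD2 : ∀ s t t', t ≤ t' → D s t' → D s t) {t t' : α} (htt' : t ≤ t')
    (s : α) : cw D W s t * (if D s t' then (1 : R) else 0) = cw D W s t' := by
  by_cases h : D s t'
  · rw [if_pos h, mul_one, cw_of_D h, cw_of_D (hD2 s t t' htt' h)]
  · rw [if_neg h, mul_zero, cw_of_not_D h]

omit [DecidableEq α] in
/-- **Monotonicity**: `K u` is antitone for monotone `u` (conditioning on a smaller down-set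
lowers the mean of an increasing function). -/
lemma antitone_K_of_monotone (hD1 : ∀ s s' t, s ≤ s' → D s' t → D s t)
    (hD2 : ∀ s t t', t ≤ t' → D s t' → D s t) (hZ : ∀ t, 0 < Z D W t) (hH1 : CondPA D W)
    {u : α → R} (hu : Monotone u) : Antitone (K D W u) := by
  intro t t' htt'
  have hχ : Monotone (fun s => - (if D s t' then (1 : R) else 0)) := by
    intro a b hab
    simp only
    by_cases hb : D b t'
    · have ha : D a t' := hD1 a b t' hab hb
      rw [if_pos ha, if_pos hb]
    · rw [if_neg hb]
      split_ifs <;> norm_num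
  have h1 := hH1 t u _ hu hχ
  have e1 : ∑ s, cw D W s t * -(if D s t' then (1 : R) else 0) = - Z D W t' := by
    unfold Z
    rw [← Finset.sum_neg_distrib]
    refine Finset.sum_congr rfl fun s _ => ?_
    rw [mul_neg, cw_mul_indicator hD2 htt' s]
  have e2 : ∑ s, cw D W s t * (u s * -(if D s t' then (1 : R) else 0)) =
      - ∑ s, cw D W s t' * u s := by
    rw [← Finset.sum_neg_distrib]
    refine Finset.sum_congr rfl fun s _ => ?_
    rw [← cw_mul_indicator hD2 htt' s]; ring
  rw [e1, e2, sum_cw_mul_eq_K_mul_Z u (hZ t).ne', sum_cw_mul_eq_K_mul_Z u (hZ t').ne'] at h1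
  have h2 : K D W u t' * (Z D W t' * Z D W t) ≤ K D W u t * (Z D W t' * Z D W t) := by
    nlinarith [h1]
  exact le_of_mul_le_mul_right h2 (mul_pos (hZ t') (hZ t))

omit [DecidableEq α] in
/-- `K u` is monotone for antitone `u`. -/
lemma monotone_K_of_antitone (hD1 : ∀ s s' t, s ≤ s' → D s' t → D s t)
    (hD2 : ∀ s t t', t ≤ t' → D s t' → D s t) (hZ : ∀ t, 0 < Z D W t) (hH1 : CondPA D W)
    {u : α → R} (hu : Antitone u) : Monotone (K D W u) := by
  have hu' : Monotone (fun s => - u s) := fun a b hab => neg_le_neg (hu hab)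
  have h := antitone_K_of_monotone hD1 hD2 hZ hH1 hu'
  intro a b hab
  have := h hab
  rw [K_neg, K_neg] at this
  linarith

omit [DecidableEq α] in
/-- `K` preserves the same-type property (swapping monotone and antitone). -/
lemma sameType_K (hD1 : ∀ s s' t, s ≤ s' → D s' t → D s t)
    (hD2 : ∀ s t t', t ≤ t' → D s t' → D s t) (hZ : ∀ t, 0 < Z D W t) (hH1 : CondPA D W)
    {u v : α → R} (huv : SameType u v) : SameType (K D W u) (K D W v) := by
  rcases huv with ⟨hu, hv⟩ | ⟨hu, hv⟩
  · exact Or.inr ⟨antitone_K_of_monotone hD1 hD2 hZ hH1 hu,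
      antitone_K_of_monotone hD1 hD2 hZ hH1 hv⟩
  · exact Or.inl ⟨monotone_K_of_antitone hD1 hD2 hZ hH1 hu,
      monotone_K_of_antitone hD1 hD2 hZ hH1 hv⟩

omit [DecidableEq α] in
/-- The iterates of a same-type pair stay of the same type. -/
lemma sameType_iterate (hD1 : ∀ s s' t, s ≤ s' → D s' t → D s t)
    (hD2 : ∀ s t t', t ≤ t' → D s t' → D s t) (hZ : ∀ t, 0 < Z D W t) (hH1 : CondPA D W)
    {u v : α → R} (huv : SameType u v) (n : ℕ) :
    SameType ((K D W)^[n] u) ((K D W)^[n] v) := by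
  induction n with
  | zero => simpa using huv
  | succ n ih =>
    rw [Function.iterate_succ_apply', Function.iterate_succ_apply']
    exact sameType_K hD1 hD2 hZ hH1 ih

omit [DecidableEq α] in
/-- The chain of pair sums is non-increasing along the iterates. -/
lemma pairSum_iterate_le (hW : ∀ s, 0 ≤ W s) (hD : ∀ s t, D s t → D t s)
    (hD1 : ∀ s s' t, s ≤ s' → D s' t → D s t) (hD2 : ∀ s t t', t ≤ t' → D s t' → D s t)
    (hZ : ∀ t, 0 < Z D W t) (hH1 : CondPA D W) {u v : α → R} (huv : SameType u v) (n : ℕ) :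
    pairSum D W ((K D W)^[n] u) ((K D W)^[n] v) ≤ pairSum D W u v := by
  induction n with
  | zero => simp
  | succ n ih =>
    rw [Function.iterate_succ_apply', Function.iterate_succ_apply']
    exact (pairSum_K_le hW hD hZ hH1 (sameType_iterate hD1 hD2 hZ hH1 huv n)).trans ih

omit [DecidableEq α] [Preorder α] [IsStrictOrderedRing R] in
/-- The iterates keep the `q`-mean. -/
lemma sum_q_mul_iterate (hD : ∀ s t, D s t → D t s) (hZ : ∀ t, 0 < Z D W t) (u : α → R) (n : ℕ) :
    ∑ t, q D W t * (K D W)^[n] u t = ∑ t, q D W t * u t := by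
  induction n with
  | zero => simp
  | succ n ih =>
    rw [Function.iterate_succ_apply', sum_q_mul_K hD (fun t => (hZ t).ne'), ih]

omit [Preorder α] in
/-- The oscillation of the iterates decays geometrically. -/
lemma osc_iterate_le (hW : ∀ s, 0 ≤ W s) {t₀ : α} (hD0 : ∀ t, D t₀ t) (h0 : 0 < W t₀)
    (u : α → R) (n : ℕ) :
    hi t₀ ((K D W)^[n] u) - lo t₀ ((K D W)^[n] u) ≤
      (1 - eps W t₀) ^ n * (hi t₀ u - lo t₀ u) := by
  induction n with
  | zero => simp
  | succ n ih =>
    rw [Function.iterate_succ_apply', pow_succ]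
    calc hi t₀ (K D W ((K D W)^[n] u)) - lo t₀ (K D W ((K D W)^[n] u))
        ≤ (1 - eps W t₀) * (hi t₀ ((K D W)^[n] u) - lo t₀ ((K D W)^[n] u)) :=
          osc_K_le hW hD0 h0 _
      _ ≤ (1 - eps W t₀) * ((1 - eps W t₀) ^ n * (hi t₀ u - lo t₀ u)) :=
          mul_le_mul_of_nonneg_left ih (sub_nonneg.mpr (eps_le_one hW h0))
      _ = (1 - eps W t₀) ^ n * (1 - eps W t₀) * (hi t₀ u - lo t₀ u) := by ring

/-- **The alternating theorem**: with (H1) on every conditional weight and a hub `t₀` (bottom,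
compatible with everything, positive weight), the W-form is nonnegative on monotone pairs. -/
theorem Q_nonneg_of_alternating [Archimedean R] (hW : ∀ s, 0 ≤ W s)
    (hD : ∀ s t, D s t → D t s) (hD1 : ∀ s s' t, s ≤ s' → D s' t → D s t)
    (t₀ : α) (hD0 : ∀ t, D t₀ t) (h0 : 0 < W t₀) (hH1 : CondPA D W)
    {g h : α → R} (hg : Monotone g) (hh : Monotone h) : 0 ≤ Q D W g h := by
  have hD2 : ∀ s t t', t ≤ t' → D s t' → D s t := fun s t t' htt' h' =>
    hD t s (hD1 t t' s htt' (hD s t' h'))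
  have hZ : ∀ t, 0 < Z D W t := fun t => Z_pos hW (hD0 t) h0
  have hM : 0 < ∑ t, q D W t := by
    refine lt_of_lt_of_le (mul_pos h0 (hZ t₀)) ?_
    exact Finset.single_le_sum (f := fun t => q D W t) (fun t _ => q_nonneg hW t) (Finset.mem_univ t₀)
  set Φ : α → R := fun t => K D W g t - g t with hΦ
  set Ψ : α → R := fun t => K D W h t - h t with hΨ
  have hΦa : Antitone Φ := fun a b hab => by
    simp only [hΦ]; linarith [antitone_K_of_monotone hD1 hD2 hZ hH1 hg hab, hg hab]
  have hΨa : Antitone Ψ := fun a b hab => by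
    simp only [hΨ]; linarith [antitone_K_of_monotone hD1 hD2 hZ hH1 hh hab, hh hab]
  have hST : SameType Φ Ψ := Or.inr ⟨hΦa, hΨa⟩
  have hΦ0 : ∑ t, q D W t * Φ t = 0 := by
    simp only [hΦ, mul_sub, Finset.sum_sub_distrib, sum_q_mul_K hD (fun t => (hZ t).ne'), sub_self]
  have hΨ0 : ∑ t, q D W t * Ψ t = 0 := by
    simp only [hΨ, mul_sub, Finset.sum_sub_distrib, sum_q_mul_K hD (fun t => (hZ t).ne'), sub_self]
  have step1 := pairSum_le_Q hW hZ hH1 hg hh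
  -- the bound for every `n`
  have key : ∀ n : ℕ,
      -((∑ t, q D W t) * ((hi t₀ Φ - lo t₀ Φ) * (hi t₀ Ψ - lo t₀ Ψ)) * (1 - eps W t₀) ^ n) ≤
        Q D W g h := by
    intro n
    have h1 := pairSum_iterate_le hW hD hD1 hD2 hZ hH1 hST n
    have hΦn : ∑ t, q D W t * (K D W)^[n] Φ t = 0 := by
      rw [sum_q_mul_iterate hD hZ, hΦ0]
    have hΨn : ∑ t, q D W t * (K D W)^[n] Ψ t = 0 := by
      rw [sum_q_mul_iterate hD hZ, hΨ0]
    have h2 := neg_le_pairSum hW t₀ hM hΦn hΨn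
    have oΦ := osc_iterate_le hW hD0 h0 Φ n
    have oΨ := osc_iterate_le hW hD0 h0 Ψ n
    have hr0 : 0 ≤ (1 - eps W t₀) ^ n := pow_nonneg (sub_nonneg.mpr (eps_le_one hW h0)) n
    have hr1 : (1 - eps W t₀) ^ n ≤ 1 :=
      pow_le_one₀ (sub_nonneg.mpr (eps_le_one hW h0)) (by linarith [eps_nonneg hW h0])
    have oscΦ : 0 ≤ hi t₀ Φ - lo t₀ Φ := sub_nonneg.mpr (lo_le_hi t₀ Φ)
    have oscΨ : 0 ≤ hi t₀ Ψ - lo t₀ Ψ := sub_nonneg.mpr (lo_le_hi t₀ Ψ)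
    have oΦn : 0 ≤ hi t₀ ((K D W)^[n] Φ) - lo t₀ ((K D W)^[n] Φ) := sub_nonneg.mpr (lo_le_hi t₀ _)
    have oΨn : 0 ≤ hi t₀ ((K D W)^[n] Ψ) - lo t₀ ((K D W)^[n] Ψ) := sub_nonneg.mpr (lo_le_hi t₀ _)
    have h3 : (hi t₀ ((K D W)^[n] Φ) - lo t₀ ((K D W)^[n] Φ)) *
        (hi t₀ ((K D W)^[n] Ψ) - lo t₀ ((K D W)^[n] Ψ)) ≤
        (hi t₀ Φ - lo t₀ Φ) * (hi t₀ Ψ - lo t₀ Ψ) * (1 - eps W t₀) ^ n := by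
      calc (hi t₀ ((K D W)^[n] Φ) - lo t₀ ((K D W)^[n] Φ)) *
            (hi t₀ ((K D W)^[n] Ψ) - lo t₀ ((K D W)^[n] Ψ))
          ≤ ((1 - eps W t₀) ^ n * (hi t₀ Φ - lo t₀ Φ)) *
            ((1 - eps W t₀) ^ n * (hi t₀ Ψ - lo t₀ Ψ)) :=
            mul_le_mul oΦ oΨ oΨn (mul_nonneg hr0 oscΦ)
        _ = (hi t₀ Φ - lo t₀ Φ) * (hi t₀ Ψ - lo t₀ Ψ) * ((1 - eps W t₀) ^ n * (1 - eps W t₀) ^ n) := by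
            ring
        _ ≤ (hi t₀ Φ - lo t₀ Φ) * (hi t₀ Ψ - lo t₀ Ψ) * (1 - eps W t₀) ^ n := by
            refine mul_le_mul_of_nonneg_left ?_ (mul_nonneg oscΦ oscΨ)
            calc (1 - eps W t₀) ^ n * (1 - eps W t₀) ^ n ≤ 1 * (1 - eps W t₀) ^ n :=
                  mul_le_mul_of_nonneg_right hr1 hr0
              _ = (1 - eps W t₀) ^ n := one_mul _
    have h4 : -((∑ t, q D W t) * ((hi t₀ Φ - lo t₀ Φ) * (hi t₀ Ψ - lo t₀ Ψ)) * (1 - eps W t₀) ^ n) ≤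
        -((∑ t, q D W t) * ((hi t₀ ((K D W)^[n] Φ) - lo t₀ ((K D W)^[n] Φ)) *
          (hi t₀ ((K D W)^[n] Ψ) - lo t₀ ((K D W)^[n] Ψ)))) := by
      rw [neg_le_neg_iff, mul_assoc]
      exact mul_le_mul_of_nonneg_left h3 hM.le
    linarith [h4, h2, h1, step1]
  -- conclude by Archimedes
  by_contra hneg
  rw [not_le] at hneg
  set C : R := (∑ t, q D W t) * ((hi t₀ Φ - lo t₀ Φ) * (hi t₀ Ψ - lo t₀ Ψ)) with hC
  have hC0 : 0 ≤ C := mul_nonneg hM.le (mul_nonneg (sub_nonneg.mpr (lo_le_hi t₀ Φ))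
    (sub_nonneg.mpr (lo_le_hi t₀ Ψ)))
  have hr : 1 - eps W t₀ < 1 := by linarith [div_pos h0 (sum_W_pos hW h0), show eps W t₀ = W t₀ / ∑ s, W s from rfl]
  obtain ⟨n, hn⟩ := exists_pow_lt_of_lt_one (div_pos (neg_pos.mpr hneg) (by linarith : (0 : R) < C + 1)) hr
  have h5 := key n
  have h6 : C * (1 - eps W t₀) ^ n ≤ (C + 1) * (1 - eps W t₀) ^ n :=
    mul_le_mul_of_nonneg_right (by linarith) (pow_nonneg (sub_nonneg.mpr (eps_le_one hW h0)) n)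
  have h7 : (C + 1) * (1 - eps W t₀) ^ n < (C + 1) * (-Q D W g h / (C + 1)) :=
    mul_lt_mul_of_pos_left hn (by linarith)
  have h8 : (C + 1) * (-Q D W g h / (C + 1)) = -Q D W g h := by
    field_simp
  linarith

end AltMono

end Summit.Ventures.PercRepro2.WForm
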